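import Mathlib
import Summits.Ventures.PercRepro2.V2SP
import Summits.Ventures.PercRepro2.Tail2D
import Summits.Ventures.PercRepro2.Tail2DBundle
import Summits.Ventures.PercRepro2.Tail2DSP

/-!
# The tail calculus counts configurations (seat mine-b, cell pub-perc-repro2)

`cnt s a b` is the number of configurations of the series–parallel pattern `s` (the cell's grammar
`V2Closure.SP`: free / pinned / absent edges, series and parallel composition, flows `SP.rLab`, `SP.bLab`)
with red flow `≥ a` and blue flow `≥ b` — the two-copy tail `T(a, b)` of conjectures/MINE-B.md §30.10.
For the bundle-parallel terms `BSP` (embedded by `BSP.toSP`) the counting tail IS the tail calculus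
(`BSP.cnt_eq`), so `BSP.tail_isMTail` becomes a statement about the configuration cubes themselves:
`cnt_isMTail`, and its corollaries (TAIL-LC) `cnt_antidiag`, `cnt_row`, `cnt_col`, `cnt_submod`.
-/

open Finset

namespace Summit.Ventures.PercRepro2.Tail2D

open V2Closure

/-- the counting tail of an SP pattern: the number of configurations with red flow `≥ a` and blue
flow `≥ b`, as a sum of indicators -/
noncomputable def cnt (s : V2Closure.SP) (a b : ℤ) : ℝ :=
  ∑ x : s.Conf, if a ≤ (s.rLab x : ℤ) ∧ b ≤ (s.bLab x : ℤ) then (1 : ℝ) else 0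

/-- `cnt` is the cardinality of the set of configurations with flows `≥ (a, b)` -/
theorem cnt_eq_card (s : V2Closure.SP) (a b : ℤ) :
    cnt s a b = ((Finset.univ.filter (fun x : s.Conf => a ≤ (s.rLab x : ℤ) ∧ b ≤ (s.bLab x : ℤ))).card : ℝ) := by
  unfold cnt; rw [Finset.card_filter]; push_cast; rfl

/-- the embedding of bundle-parallel terms into the cell's SP grammar -/
def BSP.toSP : BSP → V2Closure.SP
  | .edge => .free
  | .ser a b => .ser a.toSP b.toSP
  | .pe a => .par a.toSP .free

/-- **the counting tail is the tail calculus** on bundle-parallel terms -/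
theorem BSP.cnt_eq : ∀ (t : BSP) (a b : ℤ), cnt t.toSP a b = t.tail a b
  | .edge, a, b => by
      show cnt .free a b = bconv w11 1 pt a b
      rw [bconv_w11]; unfold cnt pt
      show (∑ x : Bool, if a ≤ ((if x then 0 else 1 : ℕ) : ℤ) ∧ b ≤ ((if x then 1 else 0 : ℕ) : ℤ) then (1 : ℝ) else 0)
        = (if a ≤ 0 ∧ b - 1 ≤ 0 then (1 : ℝ) else 0) + (if a - 1 ≤ 0 ∧ b ≤ 0 then (1 : ℝ) else 0)
      rw [Fintype.sum_bool]
      norm_num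
  | .ser s t, a, b => by
      show cnt (.ser s.toSP t.toSP) a b = (fun x y => s.tail x y * t.tail x y) a b
      simp only
      rw [← BSP.cnt_eq s a b, ← BSP.cnt_eq t a b]
      unfold cnt
      rw [Finset.sum_mul_sum, ← Fintype.sum_prod_type']
      refine Finset.sum_congr rfl (fun p _ => ?_)
      simp only [SP.rLab, SP.bLab, serR, serB, Nat.cast_min, le_min_iff]
      split_ifs <;> simp_all
  | .pe s, a, b => by
      show cnt (.par s.toSP .free) a b = bconv w11 1 s.tail a b
      rw [bconv_w11, ← BSP.cnt_eq s a (b - 1), ← BSP.cnt_eq s (a - 1) b]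
      unfold cnt
      rw [← Finset.sum_add_distrib]
      show (∑ p : s.toSP.Conf × Bool, if a ≤ ((s.toSP.rLab p.1 + (if p.2 then 0 else 1) : ℕ) : ℤ)
          ∧ b ≤ ((s.toSP.bLab p.1 + (if p.2 then 1 else 0) : ℕ) : ℤ) then (1 : ℝ) else 0) = _
      rw [Fintype.sum_prod_type]
      refine Finset.sum_congr rfl (fun x _ => ?_)
      rw [Fintype.sum_bool]
      norm_num


/-- **(TAIL-M♮) on the configuration cubes of bundle-parallel series–parallel patterns**: the counting
tail is an M♮-concave tail with top level `BSP.level` -/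
theorem cnt_isMTail (t : BSP) : IsMTail (cnt t.toSP) t.level := by
  have e : cnt t.toSP = t.tail := funext (fun a => funext (fun b => BSP.cnt_eq t a b))
  rw [e]; exact BSP.tail_isMTail t

/-- **(TAIL-LC) on the configuration cubes**: `T(a+1, b-1) · T(a-1, b+1) ≤ T(a, b)²` for the number
`T(a, b)` of configurations with red flow `≥ a` and blue flow `≥ b` -/
theorem cnt_antidiag (t : BSP) (a b : ℤ) :
    cnt t.toSP (a + 1) (b - 1) * cnt t.toSP (a - 1) (b + 1) ≤ cnt t.toSP a b * cnt t.toSP a b :=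
  (cnt_isMTail t).antidiag a b

/-- log-concavity of the counting tail along rows -/
theorem cnt_row (t : BSP) (a b : ℤ) :
    cnt t.toSP (a + 2) b * cnt t.toSP a b ≤ cnt t.toSP (a + 1) b * cnt t.toSP (a + 1) b :=
  (cnt_isMTail t).row a b

/-- log-concavity of the counting tail along columns -/
theorem cnt_col (t : BSP) (a b : ℤ) :
    cnt t.toSP a (b + 2) * cnt t.toSP a b ≤ cnt t.toSP a (b + 1) * cnt t.toSP a (b + 1) :=
  (cnt_isMTail t).col a b

/-- log-submodularity of the counting tail -/
theorem cnt_submod (t : BSP) (a b : ℤ) :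
    cnt t.toSP (a + 1) (b + 1) * cnt t.toSP a b ≤ cnt t.toSP (a + 1) b * cnt t.toSP a (b + 1) :=
  (cnt_isMTail t).m1 a b

/-- the skew inequality `m2` on the counting tail -/
theorem cnt_skew₁ (t : BSP) (a b : ℤ) :
    cnt t.toSP (a + 2) (b - 1) * cnt t.toSP a b ≤ cnt t.toSP (a + 1) b * cnt t.toSP (a + 1) (b - 1) :=
  (cnt_isMTail t).m2 a b

/-- the skew inequality `m4` on the counting tail -/
theorem cnt_skew₂ (t : BSP) (a b : ℤ) :
    cnt t.toSP (a - 1) (b + 2) * cnt t.toSP a b ≤ cnt t.toSP a (b + 1) * cnt t.toSP (a - 1) (b + 1) :=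
  (cnt_isMTail t).m4 a b


/-- **BAL on the configuration cubes**: for `a ≤ b`, the number of configurations with `≥ a-1` red
and `≥ b+1` blue paths is at most the number with `≥ a` red and `≥ b` blue paths (for `a = 1`: Reimer's
inequality for these events). -/
theorem cnt_bal (t : BSP) {a b : ℤ} (hab : a ≤ b) : cnt t.toSP (a - 1) (b + 1) ≤ cnt t.toSP a b := by
  rw [BSP.cnt_eq, BSP.cnt_eq]; exact BSP.tail_bal t hab


/-- the number of configurations of the pattern `s` with red flow `≥ a` and blue flow `≥ b`, as a natural number -/
def ncnt (s : V2Closure.SP) (a b : ℤ) : ℕ :=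
  (Finset.univ.filter (fun x : s.Conf => a ≤ (s.rLab x : ℤ) ∧ b ≤ (s.bLab x : ℤ))).card

/-- `cnt` is the cast of `ncnt` -/
theorem cnt_eq_ncnt (s : V2Closure.SP) (a b : ℤ) : cnt s a b = (ncnt s a b : ℝ) := cnt_eq_card s a b

/-- **(TAIL-LC) as a statement about cardinalities**: `N(a+1, b-1) · N(a-1, b+1) ≤ N(a, b)²` for the numbers
`N(a, b)` of configurations with `≥ a` red and `≥ b` blue edge-disjoint paths -/
theorem ncnt_antidiag (t : BSP) (a b : ℤ) :
    ncnt t.toSP (a + 1) (b - 1) * ncnt t.toSP (a - 1) (b + 1) ≤ ncnt t.toSP a b * ncnt t.toSP a b := by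
  have h := cnt_antidiag t a b
  rw [cnt_eq_ncnt, cnt_eq_ncnt, cnt_eq_ncnt] at h
  exact_mod_cast h

/-- **BAL as a statement about cardinalities**: for `a ≤ b`, `N(a-1, b+1) ≤ N(a, b)` -/
theorem ncnt_bal (t : BSP) {a b : ℤ} (hab : a ≤ b) : ncnt t.toSP (a - 1) (b + 1) ≤ ncnt t.toSP a b := by
  have h := cnt_bal t hab
  rw [cnt_eq_ncnt, cnt_eq_ncnt] at h
  exact_mod_cast h

end Summit.Ventures.PercRepro2.Tail2D
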